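import Mathlib
import HarnessLib
import Summits.CriticalPhenomena.CardyFormulaZ2.Theses.CardyMagicRigidity
import Summits.CriticalPhenomena.CardyFormulaZ2.Theorems.CardyMagicRigidityTransferContinuityReduction
import Summits.CriticalPhenomena.CardyFormulaZ2.Theorems.CardyMagicRigidityMagicFormulaTSmearedCentring
import Summits.CriticalPhenomena.CardyFormulaZ2.Theorems.CardyMagicRigidityMagicFormulaTExistenceIdentification
import Summits.CriticalPhenomena.CardyFormulaZ2.Theorems.CardyMagicRigidityMagicFormulaTStubEntire
import Summits.CriticalPhenomena.CardyFormulaZ2.Theorems.CardyMagicRigidityMagicFormulaTStubNormalFamily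
import Summits.CriticalPhenomena.CardyFormulaZ2.Theorems.CardyMagicRigidityMagicFormulaTStubTaylorLimit
import Summits.CriticalPhenomena.CardyFormulaZ2.Theorems.CardyMagicRigidityMagicFormulaTStubVitaliCoeff
import Summits.CriticalPhenomena.CardyFormulaZ2.Theorems.CardyMagicRigidityMagicFormulaTSecondOrderReduction
import Summits.CriticalPhenomena.CardyFormulaZ2.Theorems.CardyMagicRigidityMagicFormulaTThirdOrderReduction
import Summits.CriticalPhenomena.CardyFormulaZ2.Theorems.CardyMagicRigidityMagicFormulaTTwoPointGlue
import Summits.CriticalPhenomena.CardyFormulaZ2.Theorems.CardyMagicRigidityMagicFormulaTFourthOrder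
import Summits.CriticalPhenomena.CardyFormulaZ2.Theorems.CardyMagicRigidityMagicFormulaTExistsLimitA2
import Summits.CriticalPhenomena.CardyFormulaZ2.Theorems.CardyMagicRigidityMagicFormulaTExistsLimitA1sq
import Literature.Probability.RandomPlanarGeometry.NestingTransform
import Literature.Probability.Percolation.FullPlaneCNL
import Literature.Probability.Percolation.TriCorrLengthExponentDecomposition

/-!
# Line `Sketch` for crux `MagicFormulaT` — registered skeleton, v11 (lead c5; = v10.1 of lead c4, EXISTENCE ∧ ANALYTIC
# GRADING of the IDENTIFICATION in the complex coupling constant, with the route-level SPLIT glue landed)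

v11 (lead c5, 2026-08-17).  Stubs UNCHANGED from v10.1 (the six below; `MagicFormulaT_of` closes the crux by name).
What v11 adds around the skeleton: (i) the strategist's route-level order-split glue
`Split.MagicFormulaT_of_subs : TwoPointT → ThreePointT → FourUpT → MagicFormulaT` (+ `coeffLimitsExistT_of_facts`,
`fourUpT_of_facts_of_identification`) LANDED verbatim as `Theorems/CardyMagicRigidityMagicFormulaTSplit.lean`
(p162993, `--supports`), so the prepared `route edit --split MagicFormulaT` (children TwoPointT support / ThreePointT
crux / FourUpT crux, `Lines/order-split.md`) can be filed `--glue-by` a tree declaration the moment a seat is offered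
it; after the split this parent closes by the glue and the six stubs below ARE the children (valueA2 ∧ valueA1sq ⊢
TwoPointT via `tp_twoPoint_of_limits`; threePoint = ThreePointT; fourPoint ∧ fiveUp ∧ publishedInputs ⊢ FourUpT via
`fourUpT_of_facts_of_identification`); (ii) two registered ORDER-3 sub-goals cut out of `stub_threePoint` and waved:
`threePoint_oddSector` — for admissible `f` odd under the lattice point reflection `z ↦ −z` the order-3 quantity
`E[3A₁³ − 12A₁A₂ + 8A₃]` is `0` EXACTLY at every mesh (reflection machinery of c1 + dilation; Disproof F5 names the
case), so the content of order 3 is the even/mixed part `T(f₊,f₊,f₊) + 3T(f₊,f₋,f₋)`; `threePoint_existsLimit_of_facts`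
— CN → SW → the order-3 quantity HAS a limit (k = 3 of `coeffLimitsExistT_of_facts` + `ho_iteratedDeriv_three_eq`), so
`ThreePointT` is "one real number per `f` vanishes".  The lead holds `stub_threePoint` (sphere dictionary: planar
neutral 3-point chiral function = sphere 4-point CLE₆ nesting function with the dimension-0 background charge
`λ* = −2π/3` at `∞`; order 3 = base-point independence of the `t³` coefficient; see `Lines/Sketch-c5-order3.md`).

Crux stmt-CriticalPhenomena-4836, `Summit.CriticalPhenomena.CardyFormulaZ2.Theses.CardyMagicRigidity.MagicFormulaT`:
for every admissible density `f` (measurable, `|f| ≤ C`, `f = 0` off `‖z‖ ≤ R`, `∫ f = 0`) the site-`𝕋`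
twisted nesting transform `Λ^𝕋_δ(f) = E_{1/2}[∏_u 2cos(∫_{W(u,·)≠0} f + π/3)]` (all honeycomb interface loops `u`
of `δ𝕋`) tends to `G(f) = exp(q(f))`, `q(f) = (3/4π²) ∬ log‖x−y‖ f(x) f(y)`, as `δ → 0⁺`.

History.  v1–v5 (gen 0 / gen 1 / c1): dense reduction `C⁺⁺ → crux` and exact centring; v6 (c2): the UV split (small
loops negligible, both lattices); v7/v7.1 (c3): EXISTENCE ∧ IDENTIFICATION — the scaling limit
`L(t f) = lim_{δ→0⁺} Λ^𝕋_δ(t f)` EXISTS for every admissible `f` (hence for every real coupling `t`) modulo the two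
published facts `exists_isFullPlaneCNLLaw` (Camia–Newman 2006) and `SmirnovWerner2001_fourArm_scalingLimit`
(Smirnov–Werner 2001): `existsLimitT_of_facts` (p144684 over p143014 p143075 p142944 p144626 …); and the crux is
equivalent, given those facts, to the identification `stub_identification` (T1, "bosonisation of full-plane CLE₆
is exact", open) — `magicFormulaT_iff_identification` (p144684).

v8 (this file, lead c4) GRADES the open identification ORDER BY ORDER IN THE COUPLING CONSTANT, adopting the
strategist's lever (`Lines/analytic-coupling.md`, s3) inside line Sketch: make the coupling complex.  At every mesh
`δ > 0` the map `Φ_δ(t) := E_{1/2}[∏_u 2cos(t·θ_u(f) + π/3)]`, `θ_u(f) = ∫_{W(u,·)≠0} f = u.nestingPhase f`, is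
an ENTIRE function of `t ∈ ℂ` (finitely many loops meet `B̄_R`, Disproof F3) with `Φ_δ|_ℝ = Λ^𝕋_δ(· f)`
(`stub_entire`); the family `(Φ_δ)_{δ→0⁺}` is NORMAL — bounded on every closed ball `‖t‖ ≤ ρ` eventually in `δ`
(`stub_normalFamily`, the landed UV machine of v6 run for complex coupling: small loops `|1+g| ≤ e^{Re g+|g|²/2}`,
band exponential moments p138445 + exact band centring p139348 + first moments p138361, big loops by the keystone
exponential moments of `N_big`); v7.1's existence theorem gives the limit of `Φ_δ(t)` at every REAL `t`; a normal
family of entire functions converging on the real axis has convergent Taylor coefficients at `0`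
(`stub_vitaliCoeff`, Vitali's theorem in the form needed, pure complex analysis); the coefficient limits are
identified with those of `G_f(t) = exp(q(f) t²)` order by order: order 0 (`Φ_δ(0) = 1`) and order 1 (EXACT
CENTRING, landed `smearedCentring` p105356) in the glue, order 2 = `stub_secondOrder` (the Schramm–Sheffield–Wilson
/ Miller–Watson–Wilson level: `4ν − 3ν₂ = 3/(2π²)` with `ν = 1/(2√3π)`, `ν₂ = 2/(3√3π) − 1/(2π²)`; published
continuum inputs + a two-point nesting-count convergence; not in the tree), orders `≥ 3` = `stub_higherOrders`
(THE OPEN CORE: vanishing of all connected twisted-nesting cumulants of full-plane CLE₆; order 3 = evenness,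
Disproof F5, the first falsifiable instance: `lim E[3A₁³ − 12A₁A₂ + 8A₃] = 0`, `A_m = Σ_u θ_u^m`); finally
coefficientwise convergence of a normal family is convergence (`stub_taylorLimit`, Cauchy estimates), so
`Φ_δ(1) → G_f(1)`, and real parts give the crux (`MagicFormulaT_of`).

What the grading buys (why v8 and not another promote-stub on `stub_identification`): the monolithic T1 is
replaced by per-order identities LINEAR in the law of CLE₆, each a statement about finitely-many-point nested
loop COUNT statistics; order 2 closes from print; order 3 is one number (MC: `|c₃| ≤ 1%·c₂`, ideator 2); the
four analytic stubs are provable now and make "existence of the scaling limit of `Λ^𝕋_δ(t f)` as an analytic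
function of `t`" a theorem modulo CN + SW.

Stubs (7 = stubs_max; all stated in TREE VOCABULARY ONLY so each lands as
`Theorems/CardyMagicRigidityMagicFormulaT<Stub>.lean --supports stmt-CriticalPhenomena-4836`; the `def`s below
are glue abbreviations and every stub inlines them verbatim):
* `stub_publishedInputs` — the two published leaves `exists_isFullPlaneCNLLaw ∧ SmirnovWerner2001_fourArm_scalingLimit`
  (v7.1's `stub_camiaNewman`, `stub_smirnovWerner`, merged to respect stubs_max; XL, undischarged);
* `stub_entire` — fixed-mesh differentiation package (entire; `Φ_δ(0)=1`; `Φ_δ'(0) = −√3·E[Σ_u θ_u]`;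
  `Φ_δ(t) = Λ^𝕋_δ(t f)` for real `t`) — LANDED p150387 `Theorems/CardyMagicRigidityMagicFormulaTStubEntire.lean`
  (wave 1), imported;
* `stub_normalFamily` — the complex UV bound — LANDED p152053 `…MagicFormulaTStubNormalFamily.lean` (wave 1), imported;
* `stub_taylorLimit` — Cauchy estimates + Tannery — LANDED p152484 `…MagicFormulaTStubTaylorLimit.lean` (wave 1), imported;
* `stub_vitaliCoeff` — Vitali on the real axis, coefficient form — LANDED p152814 `…MagicFormulaTStubVitaliCoeff.lean`
  (wave 1), imported;
* v9 (after wave 3): `stub_secondOrder` ⟸ `stub_twoPoint` (real-valued: `E[3A₁²−4A₂] → (3/2π²)∬ f f log`) via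
  `so_secondOrder_of_twoPoint` (LANDED p154602 `…MagicFormulaTSecondOrderReduction.lean`); `stub_higherOrders` split into
  `stub_threePoint` (real-valued order 3: `E[3A₁³−12A₁A₂+8A₃] → 0`, via `ho_thirdOrder_of_threePoint`, LANDED p154606
  `…MagicFormulaTThirdOrderReduction.lean`) and `stub_fourUp` (orders `≥ 4`, coefficient form); a priori uniform
  exponential moments of `A₁`, `A₂` LANDED (`ap_expMoment_powerSums`, p154958 `…MagicFormulaTPowerSumMoments.lean`).
  OPEN stubs of v9: `stub_publishedInputs` (CN ∧ SW), `stub_twoPoint` (SSW level, conditional target), `stub_threePoint`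
  (first open order), `stub_fourUp` (T1 core).
* v10 (after wave 4): `stub_twoPoint` ⟸ `stub_limitA2` (`E[A₂] → −ν∬fflog`, `ν = 1/(2√3π)`) ∧ `stub_limitA1sq`
  (`E[A₁²] → −ν₂∬fflog`, `ν₂ = 2/(3√3π) − 1/(2π²)`) via `tp_twoPoint_of_limits` (LANDED p155852 `…MagicFormulaTTwoPointGlue.lean`);
  `stub_fourUp` ⟸ `stub_fourPoint` (real-valued order 4: `E[9A₁⁴−72A₁²A₂+48A₂²+96A₁A₃−80A₄] → 12q²`, via
  `fo_fourthOrder_of_fourPoint` over `cf_iteratedDeriv_four_finprod`, LANDED p156000 `…MagicFormulaTFourthOrder.lean`) ∧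
  `stub_fiveUp` (orders `≥ 5`, coefficient form); count representation `E[A₂] = ∬ f f E[N(x∧y)]`,
  `E[A₁²] = ∬ f f E[N(x)N(y)]` LANDED (`cr_expect_powerSums_eq_counts`, p156880 `…MagicFormulaTCountRepresentation.lean`);
  exp. moments of `A₃` LANDED (`ap_expMoment_A3`, p155899 `…MagicFormulaTPowerSumMomentsA3.lean`).
  OPEN stubs of v10: `stub_publishedInputs` (CN ∧ SW), `stub_limitA2`, `stub_limitA1sq` (SSW level, conditional targets),
  `stub_threePoint` (first open order), `stub_fourPoint` (first open even order), `stub_fiveUp` (T1 core).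
* v10.1 (after wave 5): the two order-2 half-limits EXIST modulo CN + SW — `el_existsLimitA2_of_facts` (LANDED p158631
  `…MagicFormulaTExistsLimitA2.lean` over `ela2_closeComparison` p158147, `ela2_truncation` p158362) and
  `el_existsLimitA1sq_of_facts` (LANDED p159342 `…ExistsLimitA1sq.lean` over `ela1_bandMoments` p158824, `ela1_uv` p159050,
  `ela1_comparison` p158867; c3's coupling machinery cloned for `Σθ²` and `(Σθ)²`) — so `stub_limitA2`/`stub_limitA1sq`
  become the VALUE stubs `stub_valueA2`/`stub_valueA1sq` (identification of one real number per `f`).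
  OPEN stubs of v10.1: `stub_publishedInputs` (CN ∧ SW), `stub_valueA2`, `stub_valueA1sq` (SSW level, conditional
  targets), `stub_threePoint` (first open order), `stub_fourPoint` (first open even order), `stub_fiveUp` (T1 core).
Wave-2 sub-goals (registered by `stub-add`, all LANDED): `cf_iteratedDeriv_eq_integral` (all `t`-derivatives commute
with the expectation at fixed mesh; p153498 `…MagicFormulaTCoefficientExchange.lean`), `cf_iteratedDeriv_two_finprod` /
`cf_iteratedDeriv_three_finprod` (pathwise `P''(0) = 3A₁² − 4A₂`, `P'''(0) = √3(−3A₁³ + 12A₁A₂ − 8A₃)`; p153730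
`…MagicFormulaTCoefficientFormulas.lean`), `cf_magicFormulaT_iff_coefficients` (the v8 RESIDUE, unconditional:
`MagicFormulaT ↔ ∀ f adm, ∀ k ≥ 2, Φ_δ^{(k)}(0) → G_f^{(k)}(0)`; p153770 `…MagicFormulaTCoefficientResidue.lean`).
So with v8.1 (this file: 3 sorries) the crux reads: orders 0, 1 exact at every mesh; `Φ_δ''(0) = E[3A₁² − 4A₂]`,
`Φ_δ'''(0) = √3 E[−3A₁³ + 12A₁A₂ − 8A₃]` at every mesh (theorems); existence of every coefficient limit mod CN+SW
(theorem); OPEN = the values of the limits at orders 2 (SSW level) and ≥ 3 (T1).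

Disproof.lean v4 (Cruxes/MagicFormulaT/Disproof.lean) re-read 2026-08-17T06:50Z: F3 (finite product at `δ > 0`) is
what makes `Φ_δ` entire; F5 (evenness necessary) is order 3 of `stub_higherOrders`, exposed; F8
(`not_magicFormulaTEveryMesh`) respected — no fixed-mesh identity with the Gaussian is claimed, `stub_entire` /
`stub_normalFamily` assert analyticity and bounds at fixed mesh, every identification is a `δ → 0⁺` limit; F4/F9
(resists as universality) carried by orders `≥ 3`, untouched; F10 (Beffara): the isotropic input enters through
the VALUES at orders 2, ≥ 3; `_false_without_`: none; `-- Targets`: none.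
-/

noncomputable section

namespace Summit.CriticalPhenomena.CardyFormulaZ2.Cruxes.MagicFormulaT.LineSketch

open MeasureTheory Filter Set
open scoped Real Topology BigOperators ENNReal
open Literature.Probability.RandomPlanarGeometry Literature.Probability.Percolation
  Literature.Probability.LatticeModels

/-! ## Glue abbreviations (every stub below inlines them verbatim) -/

/-- **The complex-coupling transform at mesh `δ`**: `Φ_δ(t) = E_{1/2}[∏_u 2cos(t·θ_u(f) + π/3)]`, `t ∈ ℂ`,
over the loops of `siteLoopConfig δ`, `θ_u(f) = u.nestingPhase f = ∫_{W(u,·)≠0} f`. -/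
def cNestingT (f : ℂ → ℝ) (δ : ℝ) : ℂ → ℂ :=
  fun t : ℂ ↦ ∫ ω, (∏ᶠ u ∈ (siteLoopConfig δ ω).loops,
    2 * Complex.cos (t * ((u.nestingPhase f : ℝ) : ℂ) + (Real.pi : ℂ) / 3)) ∂(triSitePercolation half)

/-- The logarithmic energy coefficient `q(f) = (3/4π²) ∬ log‖x−y‖ f(x) f(y)`. -/
def logCoeffT (f : ℂ → ℝ) : ℝ := 3 / (4 * π ^ 2) * ∫ x, ∫ y, Real.log ‖x - y‖ * f x * f y

/-- **The Gaussian as an entire function of the coupling**: `G_f(t) = exp(q(f) t²)`. -/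
def cGaussianT (f : ℂ → ℝ) : ℂ → ℂ := fun t : ℂ ↦ Complex.exp (((logCoeffT f : ℝ) : ℂ) * t ^ 2)

/-! ## Stubs (tree vocabulary only) -/

/-- **Stub P (published leaves).**  Camia–Newman's full-plane CLE₆ limit of the site-`𝕋` loop ensemble
(Comm. Math. Phys. 268 (2006), Thms 1/6; the tree's named fact `exists_isFullPlaneCNLLaw`) and Smirnov–Werner's
four-arm scaling limit (Math. Res. Lett. 8 (2001), Thm 4; `SmirnovWerner2001_fourArm_scalingLimit`).  Both are
XL published theorems, undischarged in the tree; they enter ONLY through v7.1's landed existence theorem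
`existsLimitT_of_facts`.  (v7.1 registered them separately as `stub_camiaNewman` / `stub_smirnovWerner`.) -/
theorem stub_publishedInputs : exists_isFullPlaneCNLLaw ∧ SmirnovWerner2001_fourArm_scalingLimit := by
  sorry

/-- **Stub A2 (`stub_valueA2`) · ORDER 2, first half, VALUE form: a limit of `E_{1/2}[A₂]` can only be
`−ν ∬ f f log‖x−y‖`, `ν = 1/(2√3π)`** (`A₂ = Σ_u θ_u² = ∬ f(x)f(y) N_δ(x∧y)`, count representation
`cr_expect_powerSums_eq_counts` p156880; the limit EXISTS modulo CN + SW: `el_existsLimitA2_of_facts`, p158631 over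
p158147 p158362; uniform exponential moments `ap_expMoment_powerSums`, p154958).  Continuum derivation (checked on
paper): pathwise `A₂ = lim_Λ ∬ f f N_Λ(x∧y)` with the diameter cut-off `Λ`; by translation + rotation + SCALE
invariance of full-plane CLE₆, `E N_Λ(x∧y) = φ(Λ/‖x−y‖)` exactly, and `φ(s) = ν log s + c₀ + o(1)` by the renewal
theorem for the nested loops around a point (i.i.d. log-conformal-radius decrements `B`, Schramm–Sheffield–Wilson
2009: `E e^{λB} = 1/(2cos(π√(1/9 + 4λ/3)))`, `λ < 5/48`, so `E B = 2√3π = 1/ν`); neutrality kills `ν log Λ + c₀`.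
Not in the tree: CONDITIONAL target = [identification of the lattice limit with the CLE₆ quantity (continuity of
`c ↦ Σ_u θ_u(c)²` along the Camia–Newman coupling — the comparison lemma `ela2_closeComparison` p158147 is the
lattice–lattice version)] + [scale invariance + renewal structure of full-plane CLE₆ nesting] + [SSW's `E B`]. -/
theorem stub_valueA2 : ∀ (f : ℂ → ℝ) (R C : ℝ), Measurable f → (∀ z, |f z| ≤ C) →
    (∀ z, R < ‖z‖ → f z = 0) → ∫ z, f z = 0 → ∀ L : ℝ,
    Tendsto (fun δ : ℝ ↦ ∫ ω, (∑ᶠ u ∈ (siteLoopConfig δ ω).loops, u.nestingPhase f ^ 2) ∂(triSitePercolation half))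
      (𝓝[>] (0 : ℝ)) (𝓝 L) →
    L = -(1 / (2 * Real.sqrt 3 * π)) * ∫ x, ∫ y, Real.log ‖x - y‖ * f x * f y := by
  sorry

/-- **Stub A1² (`stub_valueA1sq`) · ORDER 2, second half, VALUE form: a limit of `E_{1/2}[A₁²]` can only be
`−ν₂ ∬ f f log‖x−y‖`, `ν₂ = 2/(3√3π) − 1/(2π²) = Var B/(E B)³`** (`A₁ = Σ_u θ_u = ∫ f(x) N_δ(x) dx`,
`E[A₁²] = ∬ f f E[N_δ(x)N_δ(y)]`, `cr_expect_powerSums_eq_counts`; the limit EXISTS modulo CN + SW: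
`el_existsLimitA1sq_of_facts`, p159342 over p158824 p159050 p158867).  Continuum derivation (checked on paper): `E N(x)`
is constant in `x` (translation + point-reflection invariance — the reason `smearedCentring` is exact), so by
neutrality `E[A₁²] = lim_Λ ∬ f f Cov(N_Λ(x), N_Λ(y))`; `C_Λ(x,y) := lim_{ε→0} Cov(N_{ε,Λ}(x), N_{ε,Λ}(y))` exists
(pockets are conditionally independent; UV parts have bounded covariance), `C_Λ = ν₂ log Λ + K(x,y) + o(1)` (loops of
diameter `≫ ‖x−y‖` surround both points; renewal CLT variance constant `ν₂ = Var B/(E B)³`, SSW: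
`Var B = 16π² − 12√3π`), and exact scale covariance `C_{Λ/λ}(x,y) = C_Λ(λx,λy)` forces `K(x,y) = −ν₂ log‖x−y‖ + K₀`;
neutrality kills the constants.  Not in the tree: CONDITIONAL target (same three inputs as `stub_valueA2` + SSW's
`Var B`). -/
theorem stub_valueA1sq : ∀ (f : ℂ → ℝ) (R C : ℝ), Measurable f → (∀ z, |f z| ≤ C) →
    (∀ z, R < ‖z‖ → f z = 0) → ∫ z, f z = 0 → ∀ L : ℝ,
    Tendsto (fun δ : ℝ ↦ ∫ ω, (∑ᶠ u ∈ (siteLoopConfig δ ω).loops, u.nestingPhase f) ^ 2 ∂(triSitePercolation half))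
      (𝓝[>] (0 : ℝ)) (𝓝 L) →
    L = -(2 / (3 * Real.sqrt 3 * π) - 1 / (2 * π ^ 2)) * ∫ x, ∫ y, Real.log ‖x - y‖ * f x * f y := by
  sorry

/-- **Stub 3pt (`stub_threePoint`) · ORDER 3 in its elementary form — THE FIRST OPEN ORDER (evenness, Disproof F5):
`E_{1/2}[3A₁³ − 12A₁A₂ + 8A₃] → 0`** (`A_m = Σ_u θ_u^m`; `Φ_δ^{(3)}(0) = −√3·E[3A₁³ − 12A₁A₂ + 8A₃]` is a theorem:
`ho_iteratedDeriv_three_eq`, p154606; equivalently `E[3Σ_{u,v,w distinct} θ_uθ_vθ_w − 3Σ_{u≠v} θ_u²θ_v − Σ_u θ_u³] → 0`,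
the connected three-point twisted-nesting cumulant of full-plane CLE₆ integrated against `f^{⊗3}`; uniform integrability:
`ap_expMoment_powerSums` p154958, `ap_expMoment_A3` p155899).  Exact at every mesh on `ℤ²` (height reversal, DKLM); on
`𝕋` it must EMERGE (MC: `|c₃| ≤ 1%·c₂`, ideator 2); in the continuum, modulo degenerate kernels, a function of the
triangle SHAPE must vanish identically — no formula in print (ACSW arXiv:2107.01788: three-point, simple CLE; plane order
3 = CLE₆ sphere four-point nesting with background charge, lead c1).  OPEN; the disprover's target (a certified non-zero
limit for one admissible `f` kills the line, the crux and `ℤ² ~ 𝕋` universality). -/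
theorem stub_threePoint : ∀ (f : ℂ → ℝ) (R C : ℝ), Measurable f → (∀ z, |f z| ≤ C) →
    (∀ z, R < ‖z‖ → f z = 0) → ∫ z, f z = 0 →
    Tendsto (fun δ : ℝ ↦ ∫ ω, (3 * (∑ᶠ u ∈ (siteLoopConfig δ ω).loops, u.nestingPhase f) ^ 3 -
      12 * (∑ᶠ u ∈ (siteLoopConfig δ ω).loops, u.nestingPhase f) *
        (∑ᶠ u ∈ (siteLoopConfig δ ω).loops, u.nestingPhase f ^ 2) +
      8 * (∑ᶠ u ∈ (siteLoopConfig δ ω).loops, u.nestingPhase f ^ 3)) ∂(triSitePercolation half))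
      (𝓝[>] (0 : ℝ)) (𝓝 0) := by
  sorry

/-- **Stub 4pt (`stub_fourPoint`) · ORDER 4 in its elementary form — the first open EVEN order (Wick structure):
`E_{1/2}[9A₁⁴ − 72A₁²A₂ + 48A₂² + 96A₁A₃ − 80A₄] → 12 q(f)²`**, `q(f) = (3/4π²)∬ f f log‖x−y‖`
(`Φ_δ^{(4)}(0) = E[that polynomial]` is a theorem: `fo_iteratedDeriv_four_eq_ofReal_integral`, p156000; given orders
≤ 3 it says the fourth cumulant `Φ_δ^{(4)}(0) − 3Φ_δ^{(2)}(0)²` tends to `0`).  OPEN (T1 core). -/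
theorem stub_fourPoint : ∀ (f : ℂ → ℝ) (R C : ℝ), Measurable f → (∀ z, |f z| ≤ C) →
    (∀ z, R < ‖z‖ → f z = 0) → ∫ z, f z = 0 →
    Tendsto (fun δ : ℝ ↦ ∫ ω, (9 * (∑ᶠ u ∈ (siteLoopConfig δ ω).loops, u.nestingPhase f) ^ 4 -
      72 * (∑ᶠ u ∈ (siteLoopConfig δ ω).loops, u.nestingPhase f) ^ 2 *
        (∑ᶠ u ∈ (siteLoopConfig δ ω).loops, u.nestingPhase f ^ 2) +
      48 * (∑ᶠ u ∈ (siteLoopConfig δ ω).loops, u.nestingPhase f ^ 2) ^ 2 +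
      96 * (∑ᶠ u ∈ (siteLoopConfig δ ω).loops, u.nestingPhase f) *
        (∑ᶠ u ∈ (siteLoopConfig δ ω).loops, u.nestingPhase f ^ 3) -
      80 * (∑ᶠ u ∈ (siteLoopConfig δ ω).loops, u.nestingPhase f ^ 4)) ∂(triSitePercolation half))
      (𝓝[>] (0 : ℝ)) (𝓝 (12 * (3 / (4 * π ^ 2) * ∫ x, ∫ y, Real.log ‖x - y‖ * f x * f y) ^ 2)) := by
  sorry

/-- **Stub ≥5 (`stub_fiveUp`) · all coefficients of order `≥ 5` are Gaussian in the limit — THE OPEN CORE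
("bosonisation of full-plane CLE₆ is exact", graded by order).**  For every admissible `f` and every `k ≥ 5`: if
`Φ_δ^{(k)}(0)` converges to `a` then `a = G_f^{(k)}(0)` (odd `k`: `0`; even `k = 2m`: `(2m)!/m! · q(f)^m`), i.e. the
connected `k`-point twisted-nesting cumulants of full-plane CLE₆ vanish.  Nothing in print.  Mechanisms on record (crux
ideas): Kang–Makarov radial martingales through the CLE₆ renewal (km-renewal / two-channel), anomalous Möbius covariance
(identity-charge-decoupling).  OPEN; held by the lead. -/
theorem stub_fiveUp : ∀ (f : ℂ → ℝ) (R C : ℝ), Measurable f → (∀ z, |f z| ≤ C) →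
    (∀ z, R < ‖z‖ → f z = 0) → ∫ z, f z = 0 → ∀ k : ℕ, 5 ≤ k → ∀ a : ℂ,
    Tendsto (fun δ : ℝ ↦ iteratedDeriv k (fun t : ℂ ↦ ∫ ω, (∏ᶠ u ∈ (siteLoopConfig δ ω).loops,
      2 * Complex.cos (t * ((u.nestingPhase f : ℝ) : ℂ) + (Real.pi : ℂ) / 3)) ∂(triSitePercolation half)) 0)
      (𝓝[>] (0 : ℝ)) (𝓝 a) →
    a = iteratedDeriv k (fun t : ℂ ↦ Complex.exp
      (((3 / (4 * π ^ 2) * ∫ x, ∫ y, Real.log ‖x - y‖ * f x * f y : ℝ) : ℂ) * t ^ 2)) 0 := by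
  sorry

/-! ## Glue -/

/-- `G_f` is entire. -/
theorem differentiable_cGaussianT (f : ℂ → ℝ) : Differentiable ℂ (cGaussianT f) := by
  unfold cGaussianT
  fun_prop

/-- `G_f(0) = 1`. -/
theorem cGaussianT_zero (f : ℂ → ℝ) : cGaussianT f 0 = 1 := by
  simp [cGaussianT]

/-- `G_f'(0) = 0`. -/
theorem deriv_cGaussianT_zero (f : ℂ → ℝ) : deriv (cGaussianT f) 0 = 0 := by
  have h1 : HasDerivAt (fun t : ℂ ↦ ((logCoeffT f : ℝ) : ℂ) * t ^ 2)
      (((logCoeffT f : ℝ) : ℂ) * (↑(2 : ℕ) * (0 : ℂ) ^ (2 - 1))) 0 :=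
    (hasDerivAt_pow 2 (0 : ℂ)).const_mul _
  have h2 : HasDerivAt (cGaussianT f)
      (Complex.exp (((logCoeffT f : ℝ) : ℂ) * (0 : ℂ) ^ 2) *
        (((logCoeffT f : ℝ) : ℂ) * (↑(2 : ℕ) * (0 : ℂ) ^ (2 - 1)))) 0 :=
    h1.cexp
  rw [h2.deriv]
  simp

/-- `G_f(1) = G(f)` as a complex number. -/
theorem cGaussianT_one (f : ℂ → ℝ) :
    cGaussianT f 1 = ((Real.exp (3 / (4 * π ^ 2) * ∫ x, ∫ y, Real.log ‖x - y‖ * f x * f y) : ℝ) : ℂ) := by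
  simp [cGaussianT, logCoeffT, Complex.ofReal_exp]

/-- Admissibility is stable under real scaling of the density: `t·f` is admissible with constant `|t|·C`. -/
theorem admissible_smul {f : ℂ → ℝ} {R C : ℝ} (hf : Measurable f) (hC : ∀ z, |f z| ≤ C)
    (hR : ∀ z, R < ‖z‖ → f z = 0) (h0 : ∫ z, f z = 0) (t : ℝ) :
    Measurable (fun z ↦ t * f z) ∧ (∀ z, |t * f z| ≤ |t| * C) ∧ (∀ z, R < ‖z‖ → t * f z = 0) ∧
      ∫ z, t * f z = 0 := by
  refine ⟨hf.const_mul t, fun z ↦ ?_, fun z hz ↦ by rw [hR z hz, mul_zero], ?_⟩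
  · rw [abs_mul]
    exact mul_le_mul_of_nonneg_left (hC z) (abs_nonneg t)
  · rw [integral_const_mul, h0, mul_zero]

section Composition

variable {f : ℂ → ℝ} {R C : ℝ}

/-- Stub E in glue vocabulary. -/
theorem entire_cNestingT (hf : Measurable f) (hC : ∀ z, |f z| ≤ C) (hR : ∀ z, R < ‖z‖ → f z = 0)
    (h0 : ∫ z, f z = 0) {δ : ℝ} (hδ : 0 < δ) :
    Differentiable ℂ (cNestingT f δ) ∧ cNestingT f δ 0 = 1 ∧
    deriv (cNestingT f δ) 0 = -((Real.sqrt 3 : ℝ) : ℂ) *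
      ((∫ ω, (∑ᶠ u ∈ (siteLoopConfig δ ω).loops, ∫ z in {z : ℂ | u.wind z ≠ 0}, f z)
        ∂(triSitePercolation half) : ℝ) : ℂ) ∧
    (∀ t : ℝ, cNestingT f δ (t : ℂ) =
      ((truncNestingTransform (triSitePercolation half) (siteLoopConfig δ) (fun z ↦ t * f z) 0 : ℝ) : ℂ)) :=
  stub_entire f R C hf hC hR h0 δ hδ

/-- Stub N in glue vocabulary. -/
theorem normal_cNestingT (hf : Measurable f) (hC : ∀ z, |f z| ≤ C) (hR : ∀ z, R < ‖z‖ → f z = 0)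
    (h0 : ∫ z, f z = 0) : ∀ ρ : ℝ, 0 < ρ → ∃ M : ℝ, ∀ᶠ δ in 𝓝[>] (0 : ℝ),
      ∀ t : ℂ, ‖t‖ ≤ ρ → ‖cNestingT f δ t‖ ≤ M :=
  stub_normalFamily f R C hf hC hR h0

/-- **Exact centring at order 1** (landed `smearedCentring`, p105356): `Φ_δ'(0) = 0` at every mesh. -/
theorem deriv_cNestingT_zero (hf : Measurable f) (hC : ∀ z, |f z| ≤ C) (hR : ∀ z, R < ‖z‖ → f z = 0)
    (h0 : ∫ z, f z = 0) {δ : ℝ} (hδ : 0 < δ) : deriv (cNestingT f δ) 0 = 0 := by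
  rw [(entire_cNestingT hf hC hR h0 hδ).2.2.1, smearedCentring half f R C δ hf hC hR h0 hδ]
  simp

/-- **The scaling limit of `Φ_δ(t)` exists at every REAL coupling** (v7.1's existence theorem for the
admissible density `t·f`, modulo the published leaves). -/
theorem exists_tendsto_cNestingT_real (hP : exists_isFullPlaneCNLLaw ∧ SmirnovWerner2001_fourArm_scalingLimit)
    (hf : Measurable f) (hC : ∀ z, |f z| ≤ C) (hR : ∀ z, R < ‖z‖ → f z = 0) (h0 : ∫ z, f z = 0) (t : ℝ) :
    ∃ L : ℂ, Tendsto (fun δ ↦ cNestingT f δ (t : ℂ)) (𝓝[>] (0 : ℝ)) (𝓝 L) := by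
  obtain ⟨hm, hb, hs, hi⟩ := admissible_smul hf hC hR h0 t
  obtain ⟨L, hL⟩ := existsLimitT_of_facts hP.1 hP.2 (fun z ↦ t * f z) R (|t| * C) hm hb hs hi
  refine ⟨(L : ℂ), ((Complex.continuous_ofReal.tendsto L).comp hL).congr' ?_⟩
  filter_upwards [self_mem_nhdsWithin] with δ hδ
  exact ((entire_cNestingT hf hC hR h0 hδ).2.2.2 t).symm

/-- **Coefficientwise convergence to the Gaussian at every order**, from the stubs: existence of the coefficient
limits (`stub_vitaliCoeff` on the normal family, fed by the real-coupling limits), identification at orders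
0 (`Φ_δ(0) = 1`), 1 (exact centring), 2 (existence `el_existsLimitA2_of_facts`/`el_existsLimitA1sq_of_facts` + values `stub_valueA2`/`stub_valueA1sq` +
`tp_twoPoint_of_limits` + `so_secondOrder_of_twoPoint`), 3 (`stub_threePoint` +
`ho_thirdOrder_of_threePoint`), 4 (`stub_fourPoint` + `fo_fourthOrder_of_fourPoint`), `≥ 5` (`stub_fiveUp`). -/
theorem tendsto_iteratedDeriv_cNestingT (hf : Measurable f) (hC : ∀ z, |f z| ≤ C)
    (hR : ∀ z, R < ‖z‖ → f z = 0) (h0 : ∫ z, f z = 0) (k : ℕ) :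
    Tendsto (fun δ ↦ iteratedDeriv k (cNestingT f δ) 0) (𝓝[>] (0 : ℝ))
      (𝓝 (iteratedDeriv k (cGaussianT f) 0)) := by
  have hpos : ∀ᶠ δ in 𝓝[>] (0 : ℝ), 0 < δ := self_mem_nhdsWithin
  have hdiff : ∀ᶠ δ in 𝓝[>] (0 : ℝ), Differentiable ℂ (cNestingT f δ) := by
    filter_upwards [hpos] with δ hδ using (entire_cNestingT hf hC hR h0 hδ).1
  have hcoef := stub_vitaliCoeff (cNestingT f) hdiff (normal_cNestingT hf hC hR h0)
    (exists_tendsto_cNestingT_real stub_publishedInputs hf hC hR h0)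
  match k with
  | 0 =>
      simp only [iteratedDeriv_zero, cGaussianT_zero]
      refine (tendsto_const_nhds (x := (1 : ℂ))).congr' ?_
      filter_upwards [hpos] with δ hδ
      exact (entire_cNestingT hf hC hR h0 hδ).2.1.symm
  | 1 =>
      simp only [iteratedDeriv_one, deriv_cGaussianT_zero]
      refine (tendsto_const_nhds (x := (0 : ℂ))).congr' ?_
      filter_upwards [hpos] with δ hδ
      exact (deriv_cNestingT_zero hf hC hR h0 hδ).symm
  | 2 =>
      obtain ⟨a, ha⟩ := hcoef 2
      -- existence of the two half-limits (mod CN + SW), then their values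
      obtain ⟨L₂, hL₂⟩ := el_existsLimitA2_of_facts stub_publishedInputs.1 stub_publishedInputs.2
        f R C hf hC hR h0
      obtain ⟨L₁, hL₁⟩ := el_existsLimitA1sq_of_facts stub_publishedInputs.1 stub_publishedInputs.2
        f R C hf hC hR h0
      have hv₂ := stub_valueA2 f R C hf hC hR h0 L₂ hL₂
      have hv₁ := stub_valueA1sq f R C hf hC hR h0 L₁ hL₁
      subst hv₂ hv₁
      have h2 := so_secondOrder_of_twoPoint f R C hf hC hR h0
        (tp_twoPoint_of_limits f R C hf hC hR h0 hL₂ hL₁) a ha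
      rw [h2] at ha
      exact ha
  | 3 =>
      obtain ⟨a, ha⟩ := hcoef 3
      have h3 := ho_thirdOrder_of_threePoint f R C hf hC hR h0 (stub_threePoint f R C hf hC hR h0) a ha
      rw [h3] at ha
      exact ha
  | 4 =>
      obtain ⟨a, ha⟩ := hcoef 4
      have h4 := fo_fourthOrder_of_fourPoint f R C hf hC hR h0 (stub_fourPoint f R C hf hC hR h0) a ha
      rw [h4] at ha
      exact ha
  | k + 5 =>
      obtain ⟨a, ha⟩ := hcoef (k + 5)
      have h5 := stub_fiveUp f R C hf hC hR h0 (k + 5) (by omega) a ha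
      rw [h5] at ha
      exact ha

end Composition

/-! ## Composition -/

/-- **The line closes the crux modulo its stubs.**  Coefficientwise convergence at every order
(`tendsto_iteratedDeriv_cNestingT`), then `stub_taylorLimit` on the normal family (`stub_entire`,
`stub_normalFamily`) gives `Φ_δ(1) → G_f(1)`; at the real coupling `t = 1` this is the crux's expectation
(`stub_entire`'s real identity + `Theorems.integral_site_eq`), and real parts conclude. -/
theorem MagicFormulaT_of :
    Summit.CriticalPhenomena.CardyFormulaZ2.Theses.CardyMagicRigidity.MagicFormulaT := by
  intro f R C hf hC hR h0
  have hpos : ∀ᶠ δ in 𝓝[>] (0 : ℝ), 0 < δ := self_mem_nhdsWithin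
  have hdiff : ∀ᶠ δ in 𝓝[>] (0 : ℝ), Differentiable ℂ (cNestingT f δ) := by
    filter_upwards [hpos] with δ hδ using (entire_cNestingT hf hC hR h0 hδ).1
  -- the normal family converges to the Gaussian at every coupling, in particular at `t = 1`
  have hlim := stub_taylorLimit (cNestingT f) (cGaussianT f) hdiff (differentiable_cGaussianT f)
    (normal_cNestingT hf hC hR h0) (tendsto_iteratedDeriv_cNestingT hf hC hR h0) 1
  -- back to the real transform at coupling `1`
  have hlim' : Tendsto (fun δ : ℝ ↦ ((truncNestingTransform (triSitePercolation half) (siteLoopConfig δ) f 0 :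
      ℝ) : ℂ)) (𝓝[>] (0 : ℝ))
      (𝓝 (((Real.exp (3 / (4 * π ^ 2) * ∫ x, ∫ y, Real.log ‖x - y‖ * f x * f y)) : ℝ) : ℂ)) := by
    rw [← cGaussianT_one]
    refine hlim.congr' ?_
    filter_upwards [hpos] with δ hδ
    have h1 := (entire_cNestingT hf hC hR h0 hδ).2.2.2 1
    simp only [Complex.ofReal_one, one_mul] at h1
    simpa using h1
  have key := (Complex.continuous_re.tendsto _).comp hlim'
  simp only [Function.comp_def, Complex.ofReal_re] at key
  exact key.congr' (Eventually.of_forall fun δ ↦ (Theorems.integral_site_eq f δ).symm)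

end Summit.CriticalPhenomena.CardyFormulaZ2.Cruxes.MagicFormulaT.LineSketch

end
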